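/-
Copyright (c) 2026 the pub-hodgecm-mathlib formalisation cell (harness21).  Prover seat hodgecm-mathlib-LH4-p01 (g12): road M6 → F5 → dyadic chain of `stub_DyUnramCore` (D-UNR) —
the S3-id chain ABOVE the 2-free level-two fold (★ `…OfShalikaRank` ∕ `…OfShalikaRankOfFormCongr` with the `v ∤ 2` binder deleted); 2026-09-03.
-/
import Literature.NumberTheory.Rogawski1990.LocalTransferAtOneOfShalikaRankOfFormCongr     -- ★ (F0P2-p02 (g12)): the tame chain (pattern) + ★ `s3id_descent_of_formCongr` (2-free), ★ (H2) frame, ★ (H1-T4) `exists_nhds_localTransferAtOne_of_forall_isUnramifiedAt`, germ fold, span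
import Literature.NumberTheory.Rogawski1990.UnipotentOrbitalIntegralLevelPiecesUnramifiedAllCM  -- ★ RANK′ `exists_levelPieces_det_classOrbitalIntegral_ne_zero'` (= ★ RANK minus `h2`)
import Literature.NumberTheory.Rogawski1990.LocalTransferAtOneHyperspecialLevelTwoDyadic      -- ★ p853755 (this seat): `localTransferAtOne_of_hyperspecialLevel_le_two_of_isUnramifiedIn` (the 2-free level-two fold)
import HarnessLib

/-!
# The local transfer identity at the identity from the Shalika germ expansion at EVERY unramified inert place (no `|2|` hypothesis) — the S3-id chain above the
# dyadic level-two fold (Rogawski 1990 §8.1; Langlands–Shelstad descent §2.1)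

Topic `NumberTheory/Rogawski1990`; namespace `Literature.NumberTheory.Rogawski1990`.  THEOREMS ONLY (no definition, no instance, no notation, no named fact, no `sorry`); kernel
lane `--supports stmt-HodgeConjecture-24833`.  Cell `pub/hodgecm-mathlib` (D-0151), crux H413 = `stmt-HodgeConjecture-24833`; road M6 → F5 → the dyadic chain of organ (D-UNR)
`stub_DyUnramCore` of leaf `Cruxes/H413/Lines/F0_P3c_DyadicPaydown.lean` ED. 3 :103.  ★ `s3id_of_shalika_of_rank_of_le_two_of_det` ∕ `s3id_of_shalikaAntidiag_of_formCongr` ∕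
`s3id_of_shalikaAntidiag` (F0P2-p02 (g12)) carry `(h2 : IsUnit (2 : 𝒪_w))` ONLY as a pass-through to ‹RANK› ★ `exists_levelPieces_det_classOrbitalIntegral_ne_zero` and to the
level-two head ★ `localTransferAtOne_of_hyperspecialLevel_le_two`; both now have 2-free heads — ★ RANK′ `exists_levelPieces_det_classOrbitalIntegral_ne_zero'`
(`UnipotentOrbitalIntegralLevelPiecesUnramifiedAllCM`, binders = RANK's minus `_h2`) and ★ p853755 `localTransferAtOne_of_hyperspecialLevel_le_two_of_isUnramifiedIn` (the
θ-road fold, LH10-p01∕LH7-p04∕LH4-p01) — so THIS FILE is ★ §1∕§3∕§4 token for token with `h2` deleted and those two names swapped; §2 ★ `s3id_descent_of_formCongr` is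
2-free already and cited by name.  HEAD **`s3id_of_shalikaAntidiag_of_isUnramifiedIn`**: at a non-split place `v` UNRAMIFIED in the CM field `L` (ANY residue characteristic),
for `H′` hermitian with `det H′ ≠ 0`, `μ|_{𝕀_{L⁺}} = ω_{L∕L⁺}`, canonical families, GIVEN the Shalika germ expansion on the quasi-split `U(Φ₃)(L⁺_v)`: every `φ ∈ C_c^∞(U(H′)(L⁺_v))`
has a local `Δ‴_v[μ]`-transfer at the identity.  At `H′ = Φ₃` this is the text of the leaf's organ `stub_DyUnramCore` (whose `¬ IsUnit 2` binder is then simply unused) — the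
Summits twin and the leaf edition are the desk's word, not this file's.
HONEST LABEL: HC_CM is proved only modulo the 7 printed citations (2 remaining: hLiu418 = stmt-HodgeConjecture-24832, h413 = stmt-HodgeConjecture-24833) until rung 0 closes;
count-neutral Literature theorems (zero label movement until an edition pays the organ).

## References
* [Rogawski1990] J. D. Rogawski, *Automorphic Representations of Unitary Groups in Three Variables*, Ann. of Math. Stud. 123 (1990): §8.1 Props. 8.1.1–8.1.2 pp. 112–114;
  §4.3 (4.3.1)–(4.3.2) p. 43; §4.9 Prop. 4.9.1 p. 55; §14.4 p. 237.
* [LanglandsShelstad1990Descent] R. Langlands, D. Shelstad, *Descent for transfer factors*, The Grothendieck Festschrift II (1990): §2.1 (2.1.2).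
* [LanglandsShelstad1987] R. P. Langlands, D. Shelstad, *On the definition of transfer factors*, Math. Ann. 278 (1987): §4.2.
* [Shalika1972] J. A. Shalika, *A theorem on semi-simple 𝔭-adic groups*, Ann. of Math. 95 (1972): Thm. 2.1.1.
-/

set_option autoImplicit false

noncomputable section

open NumberField IsDedekindDomain MeasureTheory Measure Topology Filter
open Literature.NumberTheory.Rogawski1990 Literature.NumberTheory.Automorphic Literature.NumberTheory.GaloisRepresentations
open Literature.NumberTheory.Automorphic.UnitaryGroup Literature.NumberTheory.Automorphic.IntegralReduction
open Literature.AlgebraicGeometry.ShimuraVarieties (unitaryGroup hermForm)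
open scoped Matrix MatrixGroups Classical ValuativeRel

namespace Literature.NumberTheory.Rogawski1990

/-! ## §1 The contract with `det H′ ≠ 0` in place of anisotropy -/

/-- **★ p846802's CONTRACT WITH `det H′ ≠ 0` IN PLACE OF ANISOTROPY** (its proof uses anisotropy only through ★ `Godement.det_ne_zero_of_anisotropic`): at ONE non-split place
`v` unramified in `L`, `v ∤ 2`, for `H′` hermitian with `det H′ ≠ 0` and good reduction at `w`, `μ` unramified at `w`, canonical families, and the Shalika germ expansion for
`U(H′)(L⁺_v)`: the `Δ‴_v[μ]`-transfer at the identity for every `φ ∈ C_c^∞`.  Verbatim re-run of the ★ proof (germ fold ★ p846423 ∘ ‹RANK› ★ ∘ span ★ p846396 ∘ head ★).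
[cite: Rogawski1990, §8.1 Props. 8.1.1–8.1.2 pp. 112–114; §4.9 Prop. 4.9.1 p. 55] [cite: LanglandsShelstad1990Descent, §2.1 (2.1.2)] -/
theorem s3id_of_shalika_of_rank_of_le_two_of_det_of_isUnramifiedIn
    (L : Type) [Field L] [NumberField L] [IsCMField L] (H' : Matrix (Fin 3) (Fin 3) L) (μ : HeckeCharacter L)
    {v : HeightOneSpectrum (𝓞 ↥(maximalRealSubfield L))}
    (hH' : (H'.map (cmConjRingHom L)).transpose = H') (w : PlacesOver L v)
    (hw : IsCMField.complexConj L • w.1 = w.1) (hv : Algebra.IsUnramifiedIn (𝓞 L) v.asIdeal)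
    (hH'w : IsUnit (placeForm H' w.1)) (hH'i : hH'w.unit ∈ glInt 3 (w.1.adicCompletion L))
    (hμ : μ.IsUnramifiedAt w.1) (hμu : μ.IsUnitary)
    (hμω : ∀ x : ideleGroup ↥(maximalRealSubfield L), μ (AdeleRing.ideleBaseChange ↥(maximalRealSubfield L) L x) = quadraticHeckeCharCM L x)
    [MeasurableSpace ((cmDatum L 3 H').Local v)] [BorelSpace ((cmDatum L 3 H').Local v)]
    [∀ γ : ((cmDatum L 3 H').Local v), MeasurableSpace (((cmDatum L 3 H').Local v) ⧸ Subgroup.centralizer ({γ} : Set ((cmDatum L 3 H').Local v)))]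
    [∀ γ : ((cmDatum L 3 H').Local v), BorelSpace (((cmDatum L 3 H').Local v) ⧸ Subgroup.centralizer ({γ} : Set ((cmDatum L 3 H').Local v)))]
    [MeasurableSpace ((cmDatum L 2 (Matrix.of fun i j : Fin 2 => if i.val + j.val + 1 = 2 then (1 : L) else 0)).Local v × (cmDatum L 1 (Matrix.of fun i j : Fin 1 => if i.val + j.val + 1 = 1 then (1 : L) else 0)).Local v)] [BorelSpace ((cmDatum L 2 (Matrix.of fun i j : Fin 2 => if i.val + j.val + 1 = 2 then (1 : L) else 0)).Local v × (cmDatum L 1 (Matrix.of fun i j : Fin 1 => if i.val + j.val + 1 = 1 then (1 : L) else 0)).Local v)]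
  [∀ a : (cmDatum L 2 (Matrix.of fun i j : Fin 2 => if i.val + j.val + 1 = 2 then (1 : L) else 0)).Local v × (cmDatum L 1 (Matrix.of fun i j : Fin 1 => if i.val + j.val + 1 = 1 then (1 : L) else 0)).Local v, MeasurableSpace (((cmDatum L 2 (Matrix.of fun i j : Fin 2 => if i.val + j.val + 1 = 2 then (1 : L) else 0)).Local v × (cmDatum L 1 (Matrix.of fun i j : Fin 1 => if i.val + j.val + 1 = 1 then (1 : L) else 0)).Local v) ⧸ Subgroup.centralizer ({a} : Set ((cmDatum L 2 (Matrix.of fun i j : Fin 2 => if i.val + j.val + 1 = 2 then (1 : L) else 0)).Local v × (cmDatum L 1 (Matrix.of fun i j : Fin 1 => if i.val + j.val + 1 = 1 then (1 : L) else 0)).Local v)))]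
  [∀ a : (cmDatum L 2 (Matrix.of fun i j : Fin 2 => if i.val + j.val + 1 = 2 then (1 : L) else 0)).Local v × (cmDatum L 1 (Matrix.of fun i j : Fin 1 => if i.val + j.val + 1 = 1 then (1 : L) else 0)).Local v, BorelSpace (((cmDatum L 2 (Matrix.of fun i j : Fin 2 => if i.val + j.val + 1 = 2 then (1 : L) else 0)).Local v × (cmDatum L 1 (Matrix.of fun i j : Fin 1 => if i.val + j.val + 1 = 1 then (1 : L) else 0)).Local v) ⧸ Subgroup.centralizer ({a} : Set ((cmDatum L 2 (Matrix.of fun i j : Fin 2 => if i.val + j.val + 1 = 2 then (1 : L) else 0)).Local v × (cmDatum L 1 (Matrix.of fun i j : Fin 1 => if i.val + j.val + 1 = 1 then (1 : L) else 0)).Local v)))]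
    (νH : Measure ((cmDatum L 2 (Matrix.of fun i j : Fin 2 => if i.val + j.val + 1 = 2 then (1 : L) else 0)).Local v × (cmDatum L 1 (Matrix.of fun i j : Fin 1 => if i.val + j.val + 1 = 1 then (1 : L) else 0)).Local v)) [νH.IsHaarMeasure] [νH.IsMulRightInvariant]
    (νG : Measure ((cmDatum L 3 H').Local v)) [νG.IsHaarMeasure] [νG.IsMulRightInvariant]
    {mH : OrbitalMeasureFamily ((cmDatum L 2 (Matrix.of fun i j : Fin 2 => if i.val + j.val + 1 = 2 then (1 : L) else 0)).Local v × (cmDatum L 1 (Matrix.of fun i j : Fin 1 => if i.val + j.val + 1 = 1 then (1 : L) else 0)).Local v)} {mG : OrbitalMeasureFamily ((cmDatum L 3 H').Local v)}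
    (hmH : mH.IsCanonical (IsLocalGRegular L v) νH)
    (hmG : mG.IsCanonical (fun γ => IsRegularElt (γ.val : GL (Fin 3) (UnitaryGroup.LocalRing L v))) νG)
    -- `det H′ ≠ 0` (all the letter's anisotropy is used for) and ROUTE (A)'s named input at `v`
    (hdet : H'.det ≠ 0)
    (hShalika : ShalikaGermExpansionNonsplit L H' v) :
    ∀ (φ : ((cmDatum L 3 H').Local v) → ℂ), IsLocSmooth φ →
    ∃ V ∈ 𝓝 (1 : ((cmDatum L 2 (Matrix.of fun i j : Fin 2 => if i.val + j.val + 1 = 2 then (1 : L) else 0)).Local v × (cmDatum L 1 (Matrix.of fun i j : Fin 1 => if i.val + j.val + 1 = 1 then (1 : L) else 0)).Local v)), ∃ φH : ((cmDatum L 2 (Matrix.of fun i j : Fin 2 => if i.val + j.val + 1 = 2 then (1 : L) else 0)).Local v × (cmDatum L 1 (Matrix.of fun i j : Fin 1 => if i.val + j.val + 1 = 1 then (1 : L) else 0)).Local v) → ℂ, IsLocSmooth φH ∧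
        ∀ γH ∈ V, IsLocalGRegular L v γH →
          stableOrbitalIntegralRel (IsLocalStablyConjH L v) mH φH γH =
            ∑ᶠ c : ConjClasses ((cmDatum L 3 H').Local v),
              ((finExplicitCollection L H' μ (finExplicitDelta_conj_left_all L H' μ) (finExplicitDelta_conj_right_all L H' μ)) v).Δ γH (Quotient.out c) *
                classOrbitalIntegral mG φ c := by
  intro φ hφ
  -- ROUTE (A): the germ datum at `v` for the canonical family `mG`
  obtain ⟨S, mU, Γ, hS, hmU, hRao, hgerm⟩ := hShalika mG hmG.isAdmissibleOn
  -- ‹RANK›: reference pieces of hyperspecial level ≤ 2 with an invertible unipotent table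
  obtain ⟨gref, hgs, hgK, hginv, hg2, htab⟩ := exists_levelPieces_det_classOrbitalIntegral_ne_zero' L H' hH' w hw hv hH'w hH'i S hS mU hmU hRao
  -- the germ fold (★ `localTransferAtOne_of_germExpansion`) with `hspan` from ★ p846396 and `htr` from the partial head
  exact localTransferAtOne_of_germExpansion L H' v hH' hdet hmH.isAdmissibleOn
    ((finExplicitCollection L H' μ (finExplicitDelta_conj_left_all L H' μ) (finExplicitDelta_conj_right_all L H' μ)) v) mG S mU Γ hgerm gref hgs
    (fun i => localTransferAtOne_of_hyperspecialLevel_le_two_of_isUnramifiedIn L H' μ hH' w hw hv hH'w hH'i hμ hμu hμω νH νG hmH hmG (gref i) (hgs i) (hgK i) (hginv i) (hg2 i)) φ hφ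
    (exists_forall_classOrbitalIntegral_eq_sum_mul_of_det_ne_zero S mU gref htab φ)

/-! ## §3 Every hermitian form along a local similitude to `Φ₃` (Shalika for `U(Φ₃)_v` only) -/

/-- **`S3id` AT A HYPERSPECIAL-TYPE PLACE FOR EVERY HERMITIAN `H′` (`det H′ ≠ 0`, NO good-reduction hypothesis) along a local similitude `ᵗ(σT)·H′_v·T = a·Φ₃,v`**,
`μ` unramified at `w`, Shalika assumed for the quasi-split `U(Φ₃)(L⁺_v)` only: §1 at `Φ₃` (good reduction at every `w`) fed to the DESCENT §2. [cite: Rogawski1990, §14.4 p. 237; §4.9 Prop. 4.9.1 p. 55] [cite: LanglandsShelstad1987, §4.2] -/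
theorem s3id_of_shalikaAntidiag_of_formCongr_of_isUnramifiedIn
    (L : Type) [Field L] [NumberField L] [IsCMField L] (H' : Matrix (Fin 3) (Fin 3) L) (μ : HeckeCharacter L)
    {v : HeightOneSpectrum (𝓞 ↥(maximalRealSubfield L))}
    (hH' : (H'.map (cmConjRingHom L)).transpose = H') (hdet : H'.det ≠ 0) (w : PlacesOver L v)
    (hw : IsCMField.complexConj L • w.1 = w.1) (hv : Algebra.IsUnramifiedIn (𝓞 L) v.asIdeal)
    (hμ : μ.IsUnramifiedAt w.1) (hμu : μ.IsUnitary)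
    (hμω : ∀ x : ideleGroup ↥(maximalRealSubfield L), μ (AdeleRing.ideleBaseChange ↥(maximalRealSubfield L) L x) = quadraticHeckeCharCM L x)
    [MeasurableSpace ((cmDatum L 3 H').Local v)] [BorelSpace ((cmDatum L 3 H').Local v)]
    [∀ γ : ((cmDatum L 3 H').Local v), MeasurableSpace (((cmDatum L 3 H').Local v) ⧸ Subgroup.centralizer ({γ} : Set ((cmDatum L 3 H').Local v)))]
    [∀ γ : ((cmDatum L 3 H').Local v), BorelSpace (((cmDatum L 3 H').Local v) ⧸ Subgroup.centralizer ({γ} : Set ((cmDatum L 3 H').Local v)))]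
    [MeasurableSpace ((cmDatum L 2 (Matrix.of fun i j : Fin 2 => if i.val + j.val + 1 = 2 then (1 : L) else 0)).Local v × (cmDatum L 1 (Matrix.of fun i j : Fin 1 => if i.val + j.val + 1 = 1 then (1 : L) else 0)).Local v)] [BorelSpace ((cmDatum L 2 (Matrix.of fun i j : Fin 2 => if i.val + j.val + 1 = 2 then (1 : L) else 0)).Local v × (cmDatum L 1 (Matrix.of fun i j : Fin 1 => if i.val + j.val + 1 = 1 then (1 : L) else 0)).Local v)]
  [∀ a : (cmDatum L 2 (Matrix.of fun i j : Fin 2 => if i.val + j.val + 1 = 2 then (1 : L) else 0)).Local v × (cmDatum L 1 (Matrix.of fun i j : Fin 1 => if i.val + j.val + 1 = 1 then (1 : L) else 0)).Local v, MeasurableSpace (((cmDatum L 2 (Matrix.of fun i j : Fin 2 => if i.val + j.val + 1 = 2 then (1 : L) else 0)).Local v × (cmDatum L 1 (Matrix.of fun i j : Fin 1 => if i.val + j.val + 1 = 1 then (1 : L) else 0)).Local v) ⧸ Subgroup.centralizer ({a} : Set ((cmDatum L 2 (Matrix.of fun i j : Fin 2 => if i.val + j.val + 1 = 2 then (1 :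 L) else 0)).Local v × (cmDatum L 1 (Matrix.of fun i j : Fin 1 => if i.val + j.val + 1 = 1 then (1 : L) else 0)).Local v)))]
  [∀ a : (cmDatum L 2 (Matrix.of fun i j : Fin 2 => if i.val + j.val + 1 = 2 then (1 : L) else 0)).Local v × (cmDatum L 1 (Matrix.of fun i j : Fin 1 => if i.val + j.val + 1 = 1 then (1 : L) else 0)).Local v, BorelSpace (((cmDatum L 2 (Matrix.of fun i j : Fin 2 => if i.val + j.val + 1 = 2 then (1 : L) else 0)).Local v × (cmDatum L 1 (Matrix.of fun i j : Fin 1 => if i.val + j.val + 1 = 1 then (1 : L) else 0)).Local v) ⧸ Subgroup.centralizer ({a} : Set ((cmDatum L 2 (Matrix.of fun i j : Fin 2 => if i.val + j.val + 1 = 2 then (1 : L) else 0)).Local v × (cmDatum L 1 (Matrix.of fun i j : Fin 1 => if i.val + j.val + 1 = 1 then (1 : L) else 0)).Local v)))]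
    (νH : Measure ((cmDatum L 2 (Matrix.of fun i j : Fin 2 => if i.val + j.val + 1 = 2 then (1 : L) else 0)).Local v × (cmDatum L 1 (Matrix.of fun i j : Fin 1 => if i.val + j.val + 1 = 1 then (1 : L) else 0)).Local v)) [νH.IsHaarMeasure] [νH.IsMulRightInvariant]
    (νG : Measure ((cmDatum L 3 H').Local v)) [νG.IsHaarMeasure] [νG.IsMulRightInvariant]
    {mH : OrbitalMeasureFamily ((cmDatum L 2 (Matrix.of fun i j : Fin 2 => if i.val + j.val + 1 = 2 then (1 : L) else 0)).Local v × (cmDatum L 1 (Matrix.of fun i j : Fin 1 => if i.val + j.val + 1 = 1 then (1 : L) else 0)).Local v)} {mG : OrbitalMeasureFamily ((cmDatum L 3 H').Local v)}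
    (hmH : mH.IsCanonical (IsLocalGRegular L v) νH)
    (hmG : mG.IsCanonical (fun γ => IsRegularElt (γ.val : GL (Fin 3) (UnitaryGroup.LocalRing L v))) νG)
    -- the frame: a local similitude `ᵗ(σT)·H′_v·T = a·Φ₃,v` (★ `exists_formCongr_conjLocal_eq_smul_antidiag_three`), `e := cmDatumLocalCongr L v T ha h`
    (T : GL (Fin 3) (UnitaryGroup.LocalRing L v)) {a : UnitaryGroup.LocalRing L v} (ha : IsUnit a)
    (haσ : UnitaryGroup.conjLocal L (IsCMField.complexConj L) v a = a)
    (h : formCongr (UnitaryGroup.conjLocal L (IsCMField.complexConj L) v) T (H'.map (algebraMap L (UnitaryGroup.LocalRing L v))) =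
      a • (Matrix.of fun i j : Fin 3 => if i.val + j.val + 1 = 3 then (1 : L) else 0).map (algebraMap L (UnitaryGroup.LocalRing L v)))
    -- ROUTE (A)'s named input at `v` FOR THE QUASI-SPLIT FORM `Φ₃` only
    (hShalika : ShalikaGermExpansionNonsplit L (Matrix.of fun i j : Fin 3 => if i.val + j.val + 1 = 3 then (1 : L) else 0) v) :
    ∀ (φ : ((cmDatum L 3 H').Local v) → ℂ), IsLocSmooth φ →
    ∃ V ∈ 𝓝 (1 : ((cmDatum L 2 (Matrix.of fun i j : Fin 2 => if i.val + j.val + 1 = 2 then (1 : L) else 0)).Local v × (cmDatum L 1 (Matrix.of fun i j : Fin 1 => if i.val + j.val + 1 = 1 then (1 : L) else 0)).Local v)), ∃ φH : ((cmDatum L 2 (Matrix.of fun i j : Fin 2 => if i.val + j.val + 1 = 2 then (1 : L) else 0)).Local v × (cmDatum L 1 (Matrix.of fun i j : Fin 1 => if i.val + j.val + 1 = 1 then (1 : L) else 0)).Local v) → ℂ, IsLocSmooth φH ∧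
        ∀ γH ∈ V, IsLocalGRegular L v γH →
          stableOrbitalIntegralRel (IsLocalStablyConjH L v) mH φH γH =
            ∑ᶠ c : ConjClasses ((cmDatum L 3 H').Local v),
              ((finExplicitCollection L H' μ (finExplicitDelta_conj_left_all L H' μ) (finExplicitDelta_conj_right_all L H' μ)) v).Δ γH (Quotient.out c) *
                classOrbitalIntegral mG φ c := by
  intro φ hφ
  refine s3id_descent_of_formCongr L H' μ hH' hdet w hw νG mH hmG T ha haσ h ?_ φ hφ
  intro _ _ _ _ νG₃ _ _ mG₃ hmG₃ φ₃ hφ₃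
  -- §1 at `Φ₃`: good reduction at every `w` (★ `isUnit_placeForm_antidiagOne`, ★ `unit_placeForm_antidiagOne_mem_glInt`), `det Φ₃ ≠ 0`
  exact s3id_of_shalika_of_rank_of_le_two_of_det_of_isUnramifiedIn L (Matrix.of fun i j : Fin 3 => if i.val + j.val + 1 = 3 then (1 : L) else 0) μ
    (antidiagOne_isHermitian L 3) w hw hv (isUnit_placeForm_antidiagOne 3 w.1) (unit_placeForm_antidiagOne_mem_glInt 3 w.1) hμ hμu hμω νH νG₃ hmH hmG₃
    (isUnit_antidiagOne_det L 3).ne_zero hShalika φ₃ hφ₃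

/-! ## §4 The end state at a hyperspecial-type place: every form, every `μ` -/

/-- **`S3id` AT EVERY HYPERSPECIAL-TYPE PLACE, FOR EVERY HERMITIAN FORM AND EVERY `μ` OF THE LETTER, FROM SHALIKA FOR `U(Φ₃)(L⁺_v)` ALONE.**  For `H′` hermitian with
`det H′ ≠ 0`, `μ` ANY Hecke character of `L` with `μ|_{𝕀_{L⁺}} = ε_{L∕L⁺}`, `v` non-split, unramified in `L`, `v ∤ 2`, canonical families: the frame comes from ★ (H2) p846818,
the «`μ_w` unramified» hypothesis of §3 is discharged by ★ (H1-T4) p847599 (a unitary `μ₀` of the class unramified at `w` exists; the transfer twists along `μ ↦ μ₀`).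
Residual scope of `stub_N6nsS3id` after this theorem: {`v` ramified in `L`} ∪ {`v ∣ 2`}. [cite: Rogawski1990, §4.9 Prop. 4.9.1 p. 55; §14.4 p. 237] [cite: LanglandsShelstad1987, §4.2]
[cite: Weil1956, §1] [cite: LanglandsShelstad1990Descent, §2.1 (2.1.2)] -/
theorem s3id_of_shalikaAntidiag_of_isUnramifiedIn
    (L : Type) [Field L] [NumberField L] [IsCMField L] (H' : Matrix (Fin 3) (Fin 3) L) (μ : HeckeCharacter L)
    {v : HeightOneSpectrum (𝓞 ↥(maximalRealSubfield L))}
    (hH' : (H'.map (cmConjRingHom L)).transpose = H') (hdet : H'.det ≠ 0) (w : PlacesOver L v)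
    (hw : IsCMField.complexConj L • w.1 = w.1) (hv : Algebra.IsUnramifiedIn (𝓞 L) v.asIdeal)
    (hμω : ∀ x : ideleGroup ↥(maximalRealSubfield L), μ (AdeleRing.ideleBaseChange ↥(maximalRealSubfield L) L x) = quadraticHeckeCharCM L x)
    [MeasurableSpace ((cmDatum L 3 H').Local v)] [BorelSpace ((cmDatum L 3 H').Local v)]
    [∀ γ : ((cmDatum L 3 H').Local v), MeasurableSpace (((cmDatum L 3 H').Local v) ⧸ Subgroup.centralizer ({γ} : Set ((cmDatum L 3 H').Local v)))]
    [∀ γ : ((cmDatum L 3 H').Local v), BorelSpace (((cmDatum L 3 H').Local v) ⧸ Subgroup.centralizer ({γ} : Set ((cmDatum L 3 H').Local v)))]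
    [MeasurableSpace ((cmDatum L 2 (Matrix.of fun i j : Fin 2 => if i.val + j.val + 1 = 2 then (1 : L) else 0)).Local v × (cmDatum L 1 (Matrix.of fun i j : Fin 1 => if i.val + j.val + 1 = 1 then (1 : L) else 0)).Local v)] [BorelSpace ((cmDatum L 2 (Matrix.of fun i j : Fin 2 => if i.val + j.val + 1 = 2 then (1 : L) else 0)).Local v × (cmDatum L 1 (Matrix.of fun i j : Fin 1 => if i.val + j.val + 1 = 1 then (1 : L) else 0)).Local v)]
  [∀ a : (cmDatum L 2 (Matrix.of fun i j : Fin 2 => if i.val + j.val + 1 = 2 then (1 : L) else 0)).Local v × (cmDatum L 1 (Matrix.of fun i j : Fin 1 => if i.val + j.val + 1 = 1 then (1 : L) else 0)).Local v, MeasurableSpace (((cmDatum L 2 (Matrix.of fun i j : Fin 2 => if i.val + j.val + 1 = 2 then (1 : L) else 0)).Local v × (cmDatum L 1 (Matrix.of fun i j : Fin 1 => if i.val + j.val + 1 = 1 then (1 : L) else 0)).Local v) ⧸ Subgroup.centralizer ({a} : Set ((cmDatum L 2 (Matrix.of fun i j : Fin 2 => if i.val + j.val + 1 = 2 then (1 :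 L) else 0)).Local v × (cmDatum L 1 (Matrix.of fun i j : Fin 1 => if i.val + j.val + 1 = 1 then (1 : L) else 0)).Local v)))]
  [∀ a : (cmDatum L 2 (Matrix.of fun i j : Fin 2 => if i.val + j.val + 1 = 2 then (1 : L) else 0)).Local v × (cmDatum L 1 (Matrix.of fun i j : Fin 1 => if i.val + j.val + 1 = 1 then (1 : L) else 0)).Local v, BorelSpace (((cmDatum L 2 (Matrix.of fun i j : Fin 2 => if i.val + j.val + 1 = 2 then (1 : L) else 0)).Local v × (cmDatum L 1 (Matrix.of fun i j : Fin 1 => if i.val + j.val + 1 = 1 then (1 : L) else 0)).Local v) ⧸ Subgroup.centralizer ({a} : Set ((cmDatum L 2 (Matrix.of fun i j : Fin 2 => if i.val + j.val + 1 = 2 then (1 : L) else 0)).Local v × (cmDatum L 1 (Matrix.of fun i j : Fin 1 => if i.val + j.val + 1 = 1 then (1 : L) else 0)).Local v)))]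
    (νH : Measure ((cmDatum L 2 (Matrix.of fun i j : Fin 2 => if i.val + j.val + 1 = 2 then (1 : L) else 0)).Local v × (cmDatum L 1 (Matrix.of fun i j : Fin 1 => if i.val + j.val + 1 = 1 then (1 : L) else 0)).Local v)) [νH.IsHaarMeasure] [νH.IsMulRightInvariant]
    (νG : Measure ((cmDatum L 3 H').Local v)) [νG.IsHaarMeasure] [νG.IsMulRightInvariant]
    {mH : OrbitalMeasureFamily ((cmDatum L 2 (Matrix.of fun i j : Fin 2 => if i.val + j.val + 1 = 2 then (1 : L) else 0)).Local v × (cmDatum L 1 (Matrix.of fun i j : Fin 1 => if i.val + j.val + 1 = 1 then (1 : L) else 0)).Local v)} {mG : OrbitalMeasureFamily ((cmDatum L 3 H').Local v)}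
    (hmH : mH.IsCanonical (IsLocalGRegular L v) νH)
    (hmG : mG.IsCanonical (fun γ => IsRegularElt (γ.val : GL (Fin 3) (UnitaryGroup.LocalRing L v))) νG)
    -- ROUTE (A)'s named input at `v` FOR THE QUASI-SPLIT FORM `Φ₃` only
    (hShalika : ShalikaGermExpansionNonsplit L (Matrix.of fun i j : Fin 3 => if i.val + j.val + 1 = 3 then (1 : L) else 0) v) :
    ∀ (φ : ((cmDatum L 3 H').Local v) → ℂ), IsLocSmooth φ →
    ∃ V ∈ 𝓝 (1 : ((cmDatum L 2 (Matrix.of fun i j : Fin 2 => if i.val + j.val + 1 = 2 then (1 : L) else 0)).Local v × (cmDatum L 1 (Matrix.of fun i j : Fin 1 => if i.val + j.val + 1 = 1 then (1 : L) else 0)).Local v)), ∃ φH : ((cmDatum L 2 (Matrix.of fun i j : Fin 2 => if i.val + j.val + 1 = 2 then (1 : L) else 0)).Local v × (cmDatum L 1 (Matrix.of fun i j : Fin 1 => if i.val + j.val + 1 = 1 then (1 : L) else 0)).Local v) → ℂ, IsLocSmooth φH ∧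
        ∀ γH ∈ V, IsLocalGRegular L v γH →
          stableOrbitalIntegralRel (IsLocalStablyConjH L v) mH φH γH =
            ∑ᶠ c : ConjClasses ((cmDatum L 3 H').Local v),
              ((finExplicitCollection L H' μ (finExplicitDelta_conj_left_all L H' μ) (finExplicitDelta_conj_right_all L H' μ)) v).Δ γH (Quotient.out c) *
                classOrbitalIntegral mG φ c := by
  intro φ hφ
  -- the frame at the non-split place (★ (H2) `HermitianFrame.exists_formCongr_conjLocal_eq_smul_antidiag_three`)
  obtain ⟨T, a, ha, haσ, h⟩ := HermitianFrame.exists_formCongr_conjLocal_eq_smul_antidiag_three L H' hH' hdet w hw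
  -- the «`μ_w` unramified» hypothesis discharged by ★ (H1-T4) `exists_nhds_localTransferAtOne_of_forall_isUnramifiedAt`
  exact exists_nhds_localTransferAtOne_of_forall_isUnramifiedAt L H' w hw hv mH mG φ
    (fun μ₀ hμ₀u hμ₀ω hμ₀ => s3id_of_shalikaAntidiag_of_formCongr_of_isUnramifiedIn L H' μ₀ hH' hdet w hw hv hμ₀ hμ₀u hμ₀ω νH νG hmH hmG T ha haσ h hShalika φ hφ)
    μ hμω

end Literature.NumberTheory.Rogawski1990

end
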